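import Literature.AnabelianGeometry.EtaleTheta.Discharge.Sec2TowerLemmas
import Mathlib.CategoryTheory.CofilteredSystem

/-!
# [EtTh] §2 discharge: Corollary 2.19 (ii) (discrete rigidity) from Corollary 2.18 (iii), (iv) —
# proof-only companion of `ThetaSystems.lean`

Mochizuki, *The Étale Theta Function and its Frobenioid-theoretic Manifestations* [EtTh],
Publ. RIMS 45 (2009), §2, Cor 2.19 (ii) pp.64–65, proof p.66: "Assertion (ii) follows immediately
from Corollary 2.18, (iv). … assertion (ii) may be thought of as a consequence of the fact that
the '`R¹lim`'s of the projective system '`{Hom(ℤ/2ℤ, ℤ/Nℤ)}_{N ∈ E}`' of Corollary 2.18, (iv), as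
well as the projective system '`{μ_N}_{N∈E}`', vanish." (locators `p.N` = PDF pages of the PRIMS
text; bib key `MochizukiEtTh2009`). PROOF-ONLY companion (no `def`, no new named fact; seat
abc-iut-L2-d1, DAG node `EtTh:Cor2.19(ii)`, LONG-CHAINS lane C2) of `ThetaSystems.lean` (seat
abc-iut-L2-t2; nothing there is edited or restated).

`ThetaEnvTower.cor219_ii_of` — the named fact `ThetaEnvTower.Cor219_ii` HOLDS for every tower
satisfying, at every level, the named facts of Cor 2.18 (iii) (`Ker(Π• ↠ Π•_Y)` = union of
centralisers; faithfulness of `Π^tp_X ↷ Π^tp_Y`) and Cor 2.18 (iv) (lifting of automorphisms of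
`Π^tp_X`; fibres = `μ_N`-conjugates of twists by `Hom(Π•_Y/Π•_Ÿ, μ_N)`; reduction `M_{M'} → M_M`),
taken as hypotheses in unfolded `ThetaEnvData`-level form (the tower has no `RigidData` per
level). Route = the printed one made explicit: (1) every automorphism of a level lies over a unique
automorphism of `Π^tp_X` (`Discharge/Sec2IsoLift.lean`), compatibly with reduction; (2) the
`Aut(Π^tp_X)`-shadow `b` of the transition cocycle `a` is split by `c_M := b_{M,1}⁻¹` (`1 ∈ E`);
lifting `c_M` (Cor 2.18 (iv)) conjugates `a` into a cocycle `a'` over `id_{Π^tp_Y}`; (3) those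
automorphisms form FINITE sets (Cor 2.18 (iv), fibres), so the twisted inverse system
`k ↦ a' · red(k)` has a section (`nonempty_sections_of_finite_inverse_system` = the vanishing
`R¹lim`); (4) `α_M := (lift of c_M) · k_M`. HONEST FRAMING: conditional discharge modulo the named
facts listed; no side is taken on [IUTchIII] Cor 3.12; typed ≠ discharged elsewhere.
-/

namespace Literature.AnabelianGeometry.EtaleTheta

universe u
open CategoryTheory Opposite

namespace ThetaEnvTower

variable {E : Set ℕ+} (T : ThetaEnvTower.{u} E)

/-- An automorphism `γ` of `Π^tp_X` under an automorphism of some `Π^tp_Y[μ_M]` preserves `Π^tp_Y`.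
[cite: MochizukiEtTh2009, Cor 2.18(iv) p.61] -/
theorem map_PiY_eq_of_over {M : E} (e : (T.level M).env ≃* (T.level M).env)
    (γ : T.PiX ≃ₜ* T.PiX) (hγ : ∀ x, ((e x).right : T.PiX) = γ (x.right : T.PiX)) :
    T.PiY.map γ.toMulEquiv.toMonoidHom = T.PiY := by
  ext g
  constructor
  · rintro ⟨h, hh, rfl⟩
    have h2 : γ h = ((e (CycEnvelope.algSection (T.level M).augY (T.level M).chi ⟨h, hh⟩)).right :
        T.PiX) := (hγ (CycEnvelope.algSection (T.level M).augY (T.level M).chi ⟨h, hh⟩)).symm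
    change γ h ∈ T.PiY
    rw [h2]
    exact ((e _).right).2
  · intro hg
    refine ⟨((e.symm (CycEnvelope.algSection (T.level M).augY (T.level M).chi ⟨g, hg⟩)).right :
      T.PiX), ((e.symm _).right).2, ?_⟩
    change γ _ = g
    rw [← hγ (e.symm (CycEnvelope.algSection (T.level M).augY (T.level M).chi ⟨g, hg⟩)),
      MulEquiv.apply_symm_apply]
    rfl

/-- `H ↦ H` under `γ` gives `H ↦ H` under `γ⁻¹`. [cite: MochizukiEtTh2009, Cor 2.18(iv) p.61] -/
theorem map_symm_eq_of_map_eq_PiX (γ : T.PiX ≃ₜ* T.PiX) (H : Subgroup T.PiX)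
    (h : H.map γ.toMulEquiv.toMonoidHom = H) : H.map γ.symm.toMulEquiv.toMonoidHom = H := by
  conv_lhs => rw [← h, Subgroup.map_map]
  exact (congrArg (H.map ·) (MonoidHom.ext fun x => γ.symm_apply_apply x :
    γ.symm.toMulEquiv.toMonoidHom.comp _ = MonoidHom.id _)).trans (Subgroup.map_id _)

/-- `e` over `γ` implies `e⁻¹` over `γ⁻¹`. [cite: MochizukiEtTh2009, Cor 2.18(iv) p.61] -/
theorem over_symm {M : E} (e : (T.level M).env ≃* (T.level M).env) (γ : T.PiX ≃ₜ* T.PiX)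
    (hγ : ∀ x, ((e x).right : T.PiX) = γ (x.right : T.PiX)) (y : (T.level M).env) :
    ((e.symm y).right : T.PiX) = γ.symm (y.right : T.PiX) := by
  apply γ.injective
  rw [← hγ, MulEquiv.apply_symm_apply, ContinuousMulEquiv.apply_symm_apply]

variable {T} in
/-- The transition cocycle of a projective system, as an identity of automorphisms:
`a_{M'',M} = a_{M',M} ∘ red(a_{M'',M'})`. [cite: MochizukiEtTh2009, Cor 2.19(ii) p.64] -/
theorem MTESystem.a_comp_eq (S : T.MTESystem) {M M' M'' : E} (h : (M : ℕ+) ∣ M')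
    (h' : (M' : ℕ+) ∣ M'') {e : MulAut (T.level M).env} (he : T.Reduces h (S.a M' M'' h') e) :
    S.a M M'' (h.trans h') = S.a M M' h * e := by
  apply MulEquiv.ext
  intro y
  obtain ⟨x, rfl⟩ := T.redEnv_surjective M M'' (h.trans h') y
  rw [S.a_comp M M' M'' h h' x, MulAut.mul_apply, T.redEnv_comp M M' M'' h h' x,
    he (T.redEnv M' M'' h' x)]

/-- **Corollary 2.19 (ii) (Discrete Rigidity) — DISCHARGED modulo Cor 2.18 (iii), (iv)**: any
projective system of mono-theta environments indexed by `E` is isomorphic to the natural one.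
Hypotheses (level-wise, `ThetaEnvData` form): `hslim` = `Cor218_iii_PiX`; `hq` =
`Cor218_iii_quotient`; `hlift` = `Cor218_iv_surjective`; `hfib` = `Cor218_iv_fibre` (first clause);
`hred` = `Cor218_iv_reduction`. [cite: MochizukiEtTh2009, Cor 2.19(ii) p.64] -/
theorem cor219_ii_of
    (hslim : ∀ x : T.PiX, (∀ h : T.PiY, x * h * x⁻¹ = h) → x = 1)
    (hq : ∀ M : E, centralizerUnion (T.level M).env =
      (CycEnvelope.proj (T.level M).augY (T.level M).chi).ker)
    (hlift : ∀ (M : E) (η : T.PiYdd → T.mu M) (hη : η ∈ T.thetaCocycles M) (γ : T.PiX ≃ₜ* T.PiX),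
      T.PiY.map γ.toMulEquiv.toMonoidHom = T.PiY →
      ∃ α : ((T.level M).modelMono hη).Iso ((T.level M).modelMono hη),
        ∀ x, ((CycEnvelope.proj (T.level M).augY (T.level M).chi (α.e x) : T.PiY) : T.PiX) =
          γ (CycEnvelope.proj (T.level M).augY (T.level M).chi x : T.PiY))
    (hfib : ∀ (M : E) (η : T.PiYdd → T.mu M) (hη : η ∈ T.thetaCocycles M)
      (α : ((T.level M).modelMono hη).Iso ((T.level M).modelMono hη)),
      (∀ x, CycEnvelope.proj (T.level M).augY (T.level M).chi (α.e x) =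
        CycEnvelope.proj (T.level M).augY (T.level M).chi x) →
      ∃ (φ : T.PiY →* T.mu M) (_ : ∀ g : T.PiYdd, φ ((T.level M).inclYdd g) = 1) (c : T.mu M),
        ∀ x : (T.level M).env, α.e x =
          MulAut.conj (CycEnvelope.inMu (T.level M).augY (T.level M).chi c)
            (CycEnvelope.inMu (T.level M).augY (T.level M).chi
              (φ (CycEnvelope.proj (T.level M).augY (T.level M).chi x)) * x))
    (hred : T.Cor218_iv_reduction) :
    T.Cor219_ii := by
  intro S
  -- (0) every automorphism of `M_M` lies over a unique automorphism of `Π^tp_X` (Cor 2.18 (iii))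
  have hγex : ∀ (M : E)
      (α : ((T.level M).modelMono (S.mem M)).Iso ((T.level M).modelMono (S.mem M))),
      ∃ γ : T.PiX ≃ₜ* T.PiX, ∀ x, ((α.e x).right : T.PiX) = γ (x.right : T.PiX) := by
    intro M α
    refine ThetaEnvData.exists_continuousMulEquiv_PiX_of_iso α ?_ hslim
    rw [← hq M]
    exact map_centralizerUnion_eq α.e
  choose γof hγof using hγex
  have hγof' : ∀ (M : E)
      (α : ((T.level M).modelMono (S.mem M)).Iso ((T.level M).modelMono (S.mem M))) (x),
      ((α.e.toMulEquiv x).right : T.PiX) = γof M α (x.right : T.PiX) := hγof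
  have huniq : ∀ (M : E)
      (α : ((T.level M).modelMono (S.mem M)).Iso ((T.level M).modelMono (S.mem M)))
      (γ : T.PiX ≃ₜ* T.PiX), (∀ x, ((α.e x).right : T.PiX) = γ (x.right : T.PiX)) →
      γ = γof M α := fun M α γ hγ =>
    ThetaEnvData.continuousMulEquiv_PiX_unique hslim α.e.toMulEquiv γ (γof M α) hγ (hγof M α)
  -- (1) isomorphisms underlying the transition twists; reductions of isomorphisms
  choose aI haI using S.isAut
  have hdesc : ∀ (M M' : E) (h : (M : ℕ+) ∣ M')
      (α' : ((T.level M').modelMono (S.mem M')).Iso ((T.level M').modelMono (S.mem M'))),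
      ∃ α : ((T.level M).modelMono (S.mem M)).Iso ((T.level M).modelMono (S.mem M)),
        T.Reduces h α'.e.toMulEquiv α.e.toMulEquiv := by
    intro M M' h α'
    obtain ⟨α₀, hα₀⟩ := hred M M' h (S.η M') (S.mem M') α'
    obtain ⟨α, hα⟩ := T.exists_iso_congr (S.compat M M' h)
      (T.red_cocycle_mem M M' h _ (S.mem M')) (S.mem M) α₀
    exact ⟨α, fun x => by rw [hα]; exact hα₀ x⟩
  choose ρI hρI using hdesc
  have hIU_mul : ∀ (M : E) (e e' : MulAut (T.level M).env),
      (∃ β : ((T.level M).modelMono (S.mem M)).Iso ((T.level M).modelMono (S.mem M)),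
        ∀ x, β.e x = e x) →
      (∃ β : ((T.level M).modelMono (S.mem M)).Iso ((T.level M).modelMono (S.mem M)),
        ∀ x, β.e x = e' x) →
      ∃ β : ((T.level M).modelMono (S.mem M)).Iso ((T.level M).modelMono (S.mem M)),
        ∀ x, β.e x = (e * e') x := by
    rintro M e e' ⟨β, hβ⟩ ⟨β', hβ'⟩
    obtain ⟨δ, hδ⟩ := ThetaEnvData.exists_iso_trans β' β
    exact ⟨δ, fun x => by rw [hδ, MulAut.mul_apply, hβ', hβ]⟩
  have hIU_inv : ∀ (M : E) (e : MulAut (T.level M).env),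
      (∃ β : ((T.level M).modelMono (S.mem M)).Iso ((T.level M).modelMono (S.mem M)),
        ∀ x, β.e x = e x) →
      ∃ β : ((T.level M).modelMono (S.mem M)).Iso ((T.level M).modelMono (S.mem M)),
        ∀ x, β.e x = e⁻¹ x := by
    rintro M e ⟨β, hβ⟩
    obtain ⟨δ, hδ⟩ := ThetaEnvData.exists_iso_symm β
    refine ⟨δ, fun x => ?_⟩
    rw [hδ, MulAut.inv_apply]
    apply β.e.injective
    rw [ContinuousMulEquiv.apply_symm_apply, hβ, MulEquiv.apply_symm_apply]
  have hIU_iso : ∀ (M : E)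
      (α : ((T.level M).modelMono (S.mem M)).Iso ((T.level M).modelMono (S.mem M))),
      ∃ β : ((T.level M).modelMono (S.mem M)).Iso ((T.level M).modelMono (S.mem M)),
        ∀ x, β.e x = α.e.toMulEquiv x := fun M α => ⟨α, fun x => rfl⟩
  -- (2) the `Aut(Π^tp_X)`-part of the cocycle is split by `c_M := b_{M,1}⁻¹`
  let e₁ : E := ⟨1, T.one_mem⟩
  have h1 : ∀ M : E, ((e₁ : E) : ℕ+) ∣ (M : ℕ+) := fun M => one_dvd _
  -- `b_{M',1} = b_{M,1} ∘ b_{M',M}`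
  have hb : ∀ (M M' : E) (h : (M : ℕ+) ∣ M'),
      γof e₁ (aI e₁ M' (h1 M')) = (γof M (aI M M' h)).trans (γof e₁ (aI e₁ M (h1 M))) := by
    intro M M' h
    symm
    refine huniq e₁ (aI e₁ M' (h1 M')) _ fun x => ?_
    have hcomp := S.a_comp_eq (h1 M) h (e := (ρI e₁ M (h1 M) (aI M M' h)).e.toMulEquiv) (by
      have := hρI e₁ M (h1 M) (aI M M' h); rwa [haI] at this)
    change (((aI e₁ M' (h1 M')).e.toMulEquiv x).right : T.PiX) = _
    rw [haI, hcomp, MulAut.mul_apply, ← haI, ContinuousMulEquiv.trans_apply,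
      hγof' e₁ (aI e₁ M (h1 M))]
    congr 1
    exact right_eq_of_reduces (hρI e₁ M (h1 M) (aI M M' h)) (hγof M (aI M M' h)) _
  -- lifts `α0_M` of `c_M = b_{M,1}⁻¹`
  have hα0ex : ∀ M : E,
      ∃ α : ((T.level M).modelMono (S.mem M)).Iso ((T.level M).modelMono (S.mem M)),
        ∀ x, ((α.e x).right : T.PiX) = (γof e₁ (aI e₁ M (h1 M))).symm (x.right : T.PiX) :=
    fun M => hlift M (S.η M) (S.mem M) (γof e₁ (aI e₁ M (h1 M))).symm
      (T.map_symm_eq_of_map_eq_PiX _ _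
        (T.map_PiY_eq_of_over (aI e₁ M (h1 M)).e.toMulEquiv _ (hγof e₁ (aI e₁ M (h1 M)))))
  choose α0 hα0 using hα0ex
  -- (3) the conjugated cocycle `a'_{M',M} := α0_M⁻¹ ∘ a_{M',M} ∘ red(α0_{M'})` is over `id_{Π_Y}`
  let a' : ∀ M M' : E, ((M : ℕ+) ∣ M') → MulAut (T.level M).env := fun M M' h =>
    (α0 M).e.toMulEquiv⁻¹ * S.a M M' h * (ρI M M' h (α0 M')).e.toMulEquiv
  have ha'IU : ∀ (M M' : E) (h : (M : ℕ+) ∣ M'),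
      ∃ β : ((T.level M).modelMono (S.mem M)).Iso ((T.level M).modelMono (S.mem M)),
        ∀ x, β.e x = a' M M' h x := fun M M' h =>
    hIU_mul M _ _ (hIU_mul M _ _ (hIU_inv M _ (hIU_iso M (α0 M)))
      (by rw [← haI]; exact hIU_iso M _)) (hIU_iso M _)
  have ha'id : ∀ (M M' : E) (h : (M : ℕ+) ∣ M') (x : (T.level M).env),
      ((a' M M' h x).right : T.PiX) = x.right := by
    intro M M' h x
    change ((((α0 M).e.toMulEquiv⁻¹ * S.a M M' h * (ρI M M' h (α0 M')).e.toMulEquiv) x).right :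
      T.PiX) = x.right
    rw [MulAut.mul_apply, MulAut.mul_apply, MulAut.inv_apply,
      T.over_symm (α0 M).e.toMulEquiv _ (hα0 M), ContinuousMulEquiv.symm_symm, ← haI,
      hγof' M (aI M M' h), right_eq_of_reduces (hρI M M' h (α0 M')) (hα0 M'),
      ← ContinuousMulEquiv.trans_apply, ← hb M M' h, ContinuousMulEquiv.apply_symm_apply]
  -- (4) the finite sets `K_M` of automorphisms of `M_M` over `id_{Π^tp_Y}`; reduction maps
  have hKfin : ∀ M : E, Set.Finite {e : MulAut (T.level M).env |
      (∃ β : ((T.level M).modelMono (S.mem M)).Iso ((T.level M).modelMono (S.mem M)),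
        ∀ x, β.e x = e x) ∧ ∀ x, (e x).right = x.right} :=
    fun M => ThetaEnvData.finite_autOverId (hfib M (S.η M) (S.mem M))
  -- reduction of an automorphism underlying an isomorphism
  have hρex : ∀ (M M' : E) (h : (M : ℕ+) ∣ M') (e' : MulAut (T.level M').env),
      (∃ β : ((T.level M').modelMono (S.mem M')).Iso ((T.level M').modelMono (S.mem M')),
        ∀ x, β.e x = e' x) →
      ∃ e : MulAut (T.level M).env,
        (∃ β : ((T.level M).modelMono (S.mem M)).Iso ((T.level M).modelMono (S.mem M)),
          ∀ x, β.e x = e x) ∧ T.Reduces h e' e := by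
    rintro M M' h e' ⟨β', hβ'⟩
    refine ⟨(ρI M M' h β').e.toMulEquiv, ⟨_, fun x => rfl⟩, fun x => ?_⟩
    rw [← hρI M M' h β']
    exact congrArg _ (hβ' x).symm
  choose ρ hρIU hρ using hρex
  -- `ρ` is the unique reduction: every other reduction agrees with it
  have hρ_eq : ∀ (M M' : E) (h : (M : ℕ+) ∣ M') (e' : MulAut (T.level M').env) (he' : _)
      (e : MulAut (T.level M).env), T.Reduces h e' e → ρ M M' h e' he' = e :=
    fun M M' h e' he' e hee => reduces_unique (hρ M M' h e' he') hee
  have hρid : ∀ (M M' : E) (h : (M : ℕ+) ∣ M') (e' : MulAut (T.level M').env) (he' : _),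
      (∀ x, ((e' x).right : T.PiX) = x.right) →
      ∀ y, ((ρ M M' h e' he' y).right : T.PiX) = y.right :=
    fun M M' h e' he' hid y => right_eq_of_reduces (γ := id) (hρ M M' h e' he') hid y
  -- the maps `f_{M'→M} : K_{M'} → K_M`, `k ↦ a'_{M',M} ∘ red(k)`
  let K : E → Type u := fun M => {e : MulAut (T.level M).env //
      (∃ β : ((T.level M).modelMono (S.mem M)).Iso ((T.level M).modelMono (S.mem M)),
        ∀ x, β.e x = e x) ∧ ∀ x, (e x).right = x.right}
  let f : ∀ M M' : E, ((M : ℕ+) ∣ M') → K M' → K M := fun M M' h k =>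
    ⟨a' M M' h * ρ M M' h k.1 k.2.1, hIU_mul M _ _ (ha'IU M M' h) (hρIU M M' h k.1 k.2.1),
      fun x => Subtype.ext (by
        rw [MulAut.mul_apply, ha'id]
        exact hρid M M' h k.1 k.2.1 (fun y => congrArg Subtype.val (k.2.2 y)) x)⟩
  -- `a'_{M,M} = 1` and `f_{M→M} = id`
  have hρ_self : ∀ (M : E) (h : (M : ℕ+) ∣ M) (e : MulAut (T.level M).env) (he : _),
      ρ M M h e he = e := fun M h e he => hρ_eq M M h e he e (reduces_self e)
  have ha'self : ∀ (M : E) (h : (M : ℕ+) ∣ M), a' M M h = 1 := by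
    intro M h
    change (α0 M).e.toMulEquiv⁻¹ * S.a M M h * (ρI M M h (α0 M)).e.toMulEquiv = 1
    rw [S.a_self, mul_one, reduces_unique (hρI M M h (α0 M)) (reduces_self _), inv_mul_cancel]
  have hfid : ∀ (M : E) (h : (M : ℕ+) ∣ M) (k : K M), f M M h k = k := by
    intro M h k
    apply Subtype.ext
    change a' M M h * ρ M M h k.1 k.2.1 = k.1
    rw [ha'self, one_mul, hρ_self]
  -- `ρ` is multiplicative and transitive
  have hρ_mul : ∀ (M M' : E) (h : (M : ℕ+) ∣ M') (e₁' e₂' : MulAut (T.level M').env) (h₁' : _)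
      (h₂' : _) (h₁₂' : _),
      ρ M M' h (e₁' * e₂') h₁₂' = ρ M M' h e₁' h₁' * ρ M M' h e₂' h₂' :=
    fun M M' h e₁' e₂' h₁' h₂' h₁₂' =>
      hρ_eq M M' h _ h₁₂' _ (reduces_mul (hρ M M' h e₁' h₁') (hρ M M' h e₂' h₂'))
  have hρ_comp : ∀ (M M' M'' : E) (h : (M : ℕ+) ∣ M') (h' : (M' : ℕ+) ∣ M'')
      (e'' : MulAut (T.level M'').env) (he'' : _) (he' : _),
      ρ M M'' (h.trans h') e'' he'' = ρ M M' h (ρ M' M'' h' e'' he'') he' :=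
    fun M M' M'' h h' e'' he'' he' =>
      hρ_eq M M'' _ e'' he'' _ (reduces_comp (hρ M' M'' h' e'' he'') (hρ M M' h _ he'))
  -- the cocycle identity `a'_{M'',M} = a'_{M',M} ∘ red(a'_{M'',M'})`
  have ha'comp : ∀ (M M' M'' : E) (h : (M : ℕ+) ∣ M') (h' : (M' : ℕ+) ∣ M''),
      a' M M'' (h.trans h') = a' M M' h * ρ M M' h (a' M' M'' h') (ha'IU M' M'' h') := by
    intro M M' M'' h h'
    -- both sides are `α0_M⁻¹ ∘ a_{M',M} ∘ w` with `w` a reduction of `a_{M'',M'} ∘ red(α0_{M''})`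
    have hw₁ : T.Reduces h (S.a M' M'' h' * (ρI M' M'' h' (α0 M'')).e.toMulEquiv)
        ((ρI M M' h (aI M' M'' h')).e.toMulEquiv *
          (ρI M M' h (ρI M' M'' h' (α0 M''))).e.toMulEquiv) := by
      refine reduces_mul ?_ (hρI M M' h _)
      have := hρI M M' h (aI M' M'' h')
      rwa [haI] at this
    have hw₂ : T.Reduces h (S.a M' M'' h' * (ρI M' M'' h' (α0 M'')).e.toMulEquiv)
        ((ρI M M' h (α0 M')).e.toMulEquiv * ρ M M' h (a' M' M'' h') (ha'IU M' M'' h')) := by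
      have h3 := reduces_mul (hρI M M' h (α0 M')) (hρ M M' h (a' M' M'' h') (ha'IU M' M'' h'))
      have : (α0 M').e.toMulEquiv * a' M' M'' h' =
          S.a M' M'' h' * (ρI M' M'' h' (α0 M'')).e.toMulEquiv := by
        change (α0 M').e.toMulEquiv * ((α0 M').e.toMulEquiv⁻¹ * S.a M' M'' h' *
          (ρI M' M'' h' (α0 M'')).e.toMulEquiv) = _
        rw [← mul_assoc, ← mul_assoc, mul_inv_cancel, one_mul]
      rwa [this] at h3
    have hw := reduces_unique hw₁ hw₂
    have hRI : (ρI M M'' (h.trans h') (α0 M'')).e.toMulEquiv =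
        (ρI M M' h (ρI M' M'' h' (α0 M''))).e.toMulEquiv :=
      reduces_unique (hρI M M'' (h.trans h') (α0 M''))
        (reduces_comp (hρI M' M'' h' (α0 M'')) (hρI M M' h _))
    have hcomp := S.a_comp_eq h h' (e := (ρI M M' h (aI M' M'' h')).e.toMulEquiv) (by
      have := hρI M M' h (aI M' M'' h'); rwa [haI] at this)
    change (α0 M).e.toMulEquiv⁻¹ * S.a M M'' (h.trans h') *
        (ρI M M'' (h.trans h') (α0 M'')).e.toMulEquiv =
      (α0 M).e.toMulEquiv⁻¹ * S.a M M' h * (ρI M M' h (α0 M')).e.toMulEquiv *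
        ρ M M' h (a' M' M'' h') (ha'IU M' M'' h')
    rw [hcomp, hRI]
    simp only [mul_assoc]
    rw [hw]
  have hfcomp : ∀ (M M' M'' : E) (h : (M : ℕ+) ∣ M') (h' : (M' : ℕ+) ∣ M'') (k : K M''),
      f M M'' (h.trans h') k = f M M' h (f M' M'' h' k) := by
    intro M M' M'' h h' k
    apply Subtype.ext
    change a' M M'' (h.trans h') * ρ M M'' (h.trans h') k.1 k.2.1 =
      a' M M' h * ρ M M' h (a' M' M'' h' * ρ M' M'' h' k.1 k.2.1) (f M' M'' h' k).2.1
    rw [ha'comp M M' M'' h h', hρ_mul M M' h _ _ (ha'IU M' M'' h') (hρIU M' M'' h' k.1 k.2.1),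
      hρ_comp M M' M'' h h' k.1 k.2.1 (hρIU M' M'' h' k.1 k.2.1), mul_assoc]
  -- (5) the inverse system of finite nonempty sets `(K_M, f)` has a section (`R¹lim = 0`)
  -- on `E` (totally ordered by divisibility) the numerical order IS divisibility
  have hdvd : ∀ M M' : E, M ≤ M' → (M : ℕ+) ∣ (M' : ℕ+) := fun M M' hle =>
    (T.total M M.2 M' M'.2).elim id fun h => by
      have : (M : ℕ+) = M' := le_antisymm hle (PNat.le_of_dvd h)
      rw [this]
  let F : (E)ᵒᵖ ⥤ Type u :=
    { obj := fun X => K X.unop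
      map := fun {X Y} g => TypeCat.ofHom (f Y.unop X.unop (hdvd _ _ (leOfHom g.unop)))
      map_id := fun X => by
        apply TypeCat.homEquiv.injective
        funext k
        exact hfid X.unop _ k
      map_comp := fun {X Y Z} g g' => by
        apply TypeCat.homEquiv.injective
        funext k
        exact hfcomp Z.unop Y.unop X.unop _ _ k }
  haveI : ∀ X : (E)ᵒᵖ, Finite (F.obj X) := fun X => (hKfin X.unop).to_subtype
  haveI : ∀ X : (E)ᵒᵖ, Nonempty (F.obj X) := fun X =>
    ⟨⟨1, ⟨MonoThetaEnv.Iso.refl _, fun x => rfl⟩, fun x => rfl⟩⟩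
  obtain ⟨u, hu⟩ := nonempty_sections_of_finite_inverse_system F
  have hsec : ∀ (M M' : E) (h : (M : ℕ+) ∣ M'), f M M' h (u (op M')) = u (op M) :=
    fun M M' h => hu (homOfLE (show M ≤ M' from PNat.le_of_dvd h)).op
  -- (6) `α_M := α0_M ∘ k_M` is the required isomorphism of projective systems
  refine ⟨fun M => (α0 M).e.toMulEquiv * (u (op M)).1, fun M => ?_, fun M M' h x => ?_⟩
  · obtain ⟨β, hβ⟩ := hIU_mul M _ _ (hIU_iso M (α0 M)) (u (op M)).2.1
    exact ⟨β, MulEquiv.ext hβ⟩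
  · have hk := congrArg Subtype.val (hsec M M' h)
    change a' M M' h * ρ M M' h (u (op M')).1 (u (op M')).2.1 = (u (op M)).1 at hk
    rw [MulAut.mul_apply, MulAut.mul_apply, ← hk]
    change _ = ((α0 M).e.toMulEquiv * ((α0 M).e.toMulEquiv⁻¹ * S.a M M' h *
      (ρI M M' h (α0 M')).e.toMulEquiv * ρ M M' h (u (op M')).1 (u (op M')).2.1)) _
    rw [← mul_assoc, ← mul_assoc, ← mul_assoc, mul_inv_cancel, one_mul, MulAut.mul_apply,
      MulAut.mul_apply, ← hρ M M' h (u (op M')).1 (u (op M')).2.1 x, ← hρI M M' h (α0 M')]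

/-- Temp-slimness of `Π^tp_X` ("every open subgroup has trivial centraliser", [SemiAnbd] Ex. 3.10)
yields both Cor 2.18 (iii) inputs of `cor219_ii_of`: faithfulness of `Π^tp_X ↷ Π^tp_Y` and, at every
level, `Ker(Π• ↠ Π•_Y)` = union of centralisers (Prop 2.11 (ii), t2's
`centralizerUnion_cycEnvelope_eq`). [cite: MochizukiEtTh2009, Cor 2.18(iii) p.61] -/
theorem cor218_iii_of_tempSlim
    (hts : ∀ U : Subgroup T.PiX, IsOpen (U : Set T.PiX) →
      ∀ z : T.PiX, (∀ u ∈ U, z * u = u * z) → z = 1) :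
    (∀ x : T.PiX, (∀ h : T.PiY, x * h * x⁻¹ = h) → x = 1) ∧
      ∀ M : E, centralizerUnion (T.level M).env =
        (CycEnvelope.proj (T.level M).augY (T.level M).chi).ker := by
  refine ⟨fun x hx => hts T.PiY T.PiY_open x fun u hu => ?_, fun M => ?_⟩
  · have := hx ⟨u, hu⟩
    change x * u * x⁻¹ = u at this
    calc x * u = x * u * x⁻¹ * x := by group
      _ = u * x := by rw [this]
  · refine centralizerUnion_cycEnvelope_eq (T.level M).augY (T.level M).chi ?_ ?_
    · intro U hU z hz
      have hUo : IsOpen ((U.map T.PiY.subtype : Subgroup T.PiX) : Set T.PiX) := by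
        rw [Subgroup.coe_map]
        exact T.PiY_open.isOpenEmbedding_subtypeVal.isOpenMap _ hU
      have := hts _ hUo z (by
        rintro _ ⟨u, hu, rfl⟩
        exact congrArg Subtype.val (hz u hu))
      exact Subtype.ext this
    · have h := T.chi_ker_open M
      have : ((((T.level M).chi.comp (T.level M).augY).ker : Subgroup T.PiY) : Set T.PiY) =
          Subtype.val ⁻¹' ((((T.chi M).comp T.aug).ker : Subgroup T.PiX) : Set T.PiX) := by
        ext g; simp [MonoidHom.mem_ker]
      rw [this]
      exact h.preimage continuous_subtype_val

/-- **Corollary 2.19 (ii) — DISCHARGED modulo temp-slimness of `Π^tp_X` and Cor 2.18 (iv)** (the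
form closest to print: Cor 2.18 (iii) is absorbed by [SemiAnbd] Ex. 3.10).
[cite: MochizukiEtTh2009, Cor 2.19(ii) p.64] -/
theorem cor219_ii_of_tempSlim
    (hts : ∀ U : Subgroup T.PiX, IsOpen (U : Set T.PiX) →
      ∀ z : T.PiX, (∀ u ∈ U, z * u = u * z) → z = 1)
    (hlift : ∀ (M : E) (η : T.PiYdd → T.mu M) (hη : η ∈ T.thetaCocycles M) (γ : T.PiX ≃ₜ* T.PiX),
      T.PiY.map γ.toMulEquiv.toMonoidHom = T.PiY →
      ∃ α : ((T.level M).modelMono hη).Iso ((T.level M).modelMono hη),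
        ∀ x, ((CycEnvelope.proj (T.level M).augY (T.level M).chi (α.e x) : T.PiY) : T.PiX) =
          γ (CycEnvelope.proj (T.level M).augY (T.level M).chi x : T.PiY))
    (hfib : ∀ (M : E) (η : T.PiYdd → T.mu M) (hη : η ∈ T.thetaCocycles M)
      (α : ((T.level M).modelMono hη).Iso ((T.level M).modelMono hη)),
      (∀ x, CycEnvelope.proj (T.level M).augY (T.level M).chi (α.e x) =
        CycEnvelope.proj (T.level M).augY (T.level M).chi x) →
      ∃ (φ : T.PiY →* T.mu M) (_ : ∀ g : T.PiYdd, φ ((T.level M).inclYdd g) = 1) (c : T.mu M),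
        ∀ x : (T.level M).env, α.e x =
          MulAut.conj (CycEnvelope.inMu (T.level M).augY (T.level M).chi c)
            (CycEnvelope.inMu (T.level M).augY (T.level M).chi
              (φ (CycEnvelope.proj (T.level M).augY (T.level M).chi x)) * x))
    (hred : T.Cor218_iv_reduction) : T.Cor219_ii :=
  T.cor219_ii_of (T.cor218_iii_of_tempSlim hts).1 (T.cor218_iii_of_tempSlim hts).2 hlift hfib hred

end ThetaEnvTower

end Literature.AnabelianGeometry.EtaleTheta
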